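import Summits.HodgeConjecture.HodgeConjecture.Theses.SevenfoldWeilCensus
import Summits.HodgeConjecture.HodgeConjecture.Theorems.PadicSemiregularLiftHodgeBeyondAnchorsUnconditional
import Literature.AlgebraicGeometry.HodgeTheory.WeilSurfaceSquareModel
import Literature.NumberTheory.EllipticCurves.DivisionPolynomialTorsion
import Literature.AlgebraicGeometry.Motives.AbelianVarietyProjectiveChart
import HarnessLib

/-!
# Residual `HodgeAbelianDimGeEight` of route SevenfoldWeilCensus already carries HC for ALL abelian varieties

Route `SevenfoldWeilCensus` of `HodgeConjecture`; helper file supporting item stmt-HodgeConjecture-18722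
(`HodgeAbelianDimGeEight`, the declared residual R1: the Hodge conjecture for complex abelian varieties of
dimension `≥ 8`). It does not close the item; it settles its STRENGTH.

`closes` splits the summit as: abelian of dimension `≤ 7` (the attacked conjunct, `Assembly` fed with the census
cruxes, the shared Weil-sixfold crux and Markman's dimension `≤ 5`), abelian of dimension `≥ 8` (R1), non-abelian
(R2 = `AbelianComplement`). This file proves, with standard axioms only:

* `hodgeAbelianVarieties_of_hodgeAbelianDimGeEight : HodgeAbelianDimGeEight → ∀ A, HodgeConjectureFor A.dim A.X`
  — R1 ALONE gives the Hodge conjecture for every complex abelian variety: pad `A` (dimension `< 8`) with factors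
  `E = ℂ/(ℤ + iℤ)` (`WeilSquare.curveAV`) up to dimension `8`, apply R1, and descend along `A × E → A` with the
  unconditional product descent `HodgeBeyondAnchors.hodgeConjectureFor_of_tensor` (general slice of an algebraic
  class; `hodgePQ_independent_of_hodgeModel_holds`, `nonempty_hodgeModel_holds`, `Infinite E(ℂ)`);
* `hodgeAbelianDimGeEight_iff_hodgeAbelianVarieties` — R1 `↔` the text of item stmt-HodgeConjecture-1333
  (`PadicSemiregularLift.HodgeAbelianVarieties`);
* `assembly_of_hodgeAbelianDimGeEight : HodgeAbelianDimGeEight → Assembly` and `hodgeConjecture_of_residuals :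
  HodgeAbelianDimGeEight → AbelianComplement → HodgeConjecture` — the route's deciding theorem needs only its two
  declared residuals; the attacked conjunct and its four inputs are not load-bearing as typed.

Reading for the planner (numbers, not adjectives): a residual "HC for abelian varieties of dimension ≥ d" is
equivalent to HC for all abelian varieties for every `d` (abelian varieties are closed under `× E`); only a
BRIDGE typing such as `(∀ A, A.dim ≤ 7 → HC A) → ∀ A, HC A` separates the conjunct from the residual.

References: C. Voisin, *Hodge Theory and Complex Algebraic Geometry I* (2002), §7.3.2, §11.3; W. Fulton,
*Intersection Theory* (1998), §10.1; J. H. Silverman, *The Arithmetic of Elliptic Curves* (2009), VI.3.6.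
-/

-- Summit.HodgeConjecture.HodgeConjecture.… repeats the summit name by the D-0017 layout (Sub = Summit).
set_option linter.dupNamespace false

noncomputable section

namespace Summit.HodgeConjecture.HodgeConjecture.Theorems.HodgeAbelianDimGeEight.Strength

open CategoryTheory MonoidalCategory
open Summit.HodgeConjecture.HodgeConjecture.Theses.SevenfoldWeilCensus
open Literature.AlgebraicGeometry.Motives Literature.AlgebraicGeometry.HodgeTheory
open Summit.HodgeConjecture.HodgeConjecture.Theorems.HodgeBeyondAnchors

/-- `Im i ≠ 0`. [folklore] -/
theorem I_im_ne_zero : Complex.I.im ≠ 0 := by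
  rw [Complex.I_im]; exact one_ne_zero

/-- `dim E = 1` for the padding curve `E = ℂ/(ℤ + iℤ)`. [cite: SilvermanAEC2009, III.3.1(c)] -/
theorem dim_padE : (WeilSquare.curveAV Complex.I I_im_ne_zero).dim = 1 := WeilSquare.dim_curveAV _ _

/-- `E` is a smooth projective curve. [cite: SilvermanAEC2009, III.3.1(c)] -/
theorem isSmoothProjective_padE : IsSmoothProjective 1 (WeilSquare.curveAV Complex.I I_im_ne_zero).X :=
  (WeilSquare.periodPair Complex.I I_im_ne_zero).curve.isSmoothProjective_scheme

/-- `E(ℂ)` is infinite (`WeierstrassCurve.infinite_point` transported along `pointEquiv`; `E_Λ ×_ℂ ℂ = E_Λ` is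
`rfl`). [cite: SilvermanAEC2009, VI.3.6] -/
theorem infinite_complexPoints_padE : Infinite (ComplexPoints (WeilSquare.curveAV Complex.I I_im_ne_zero).X) := by
  let L : PeriodPair := WeilSquare.periodPair Complex.I I_im_ne_zero
  let pe : L.curve.toAffine.Point ≃ AlgPoints L.curve.scheme ℂ := L.curve.pointEquiv (L := ℂ)
  haveI : Infinite L.curve.toAffine.Point := WeierstrassCurve.infinite_point (V := L.curve)
  exact Infinite.of_injective pe pe.injective

/-- **One padding step**: `HC(A × E) ⇒ HC(A)` for every complex abelian variety `A`, by the product descent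
along `A × E → A`. [cite: VoisinHodgeI2002, §11.3] -/
theorem hodgeConjectureFor_of_prod_padE (A : AbelianVariety ℂ)
    (h : HodgeConjectureFor (A.prod (WeilSquare.curveAV Complex.I I_im_ne_zero)).dim
      (A.prod (WeilSquare.curveAV Complex.I I_im_ne_zero)).X) :
    HodgeConjectureFor A.dim A.X := by
  have hd : (A.prod (WeilSquare.curveAV Complex.I I_im_ne_zero)).dim = A.dim + 1 := by
    rw [AbelianVariety.dim_prod, dim_padE]
  rw [hd, AbelianVariety.prod_X] at h
  have hA : IsSmoothProjective A.dim A.X := AbelianVariety.isSmoothProjective_holds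
  haveI := infinite_complexPoints_padE
  exact hodgeConjectureFor_of_tensor hodgePQ_independent_of_hodgeModel_holds hA isSmoothProjective_padE
    (nonempty_hodgeModel_holds hA) h

/-- **R1 alone gives HC for every complex abelian variety**: induct on the dimension deficit `8 - dim A`,
padding with `E`. [cite: VoisinHodgeI2002, §11.3] -/
theorem hodgeAbelianVarieties_of_hodgeAbelianDimGeEight (h₈ : HodgeAbelianDimGeEight) :
    ∀ A : AbelianVariety ℂ, HodgeConjectureFor A.dim A.X := by
  suffices H : ∀ k : ℕ, ∀ A : AbelianVariety ℂ, 8 ≤ A.dim + k → HodgeConjectureFor A.dim A.X from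
    fun A ↦ H 8 A (by omega)
  intro k
  induction k with
  | zero => exact fun A hA ↦ h₈ A (by omega) AbelianVariety.isSmoothProjective_holds
  | succ k ih =>
    intro A hA
    refine hodgeConjectureFor_of_prod_padE A (ih (A.prod (WeilSquare.curveAV Complex.I I_im_ne_zero)) ?_)
    rw [AbelianVariety.dim_prod, dim_padE]
    omega

/-- **R1 `↔` HC for all abelian varieties** (the text of item stmt-HodgeConjecture-1333,
`PadicSemiregularLift.HodgeAbelianVarieties`). [cite: VoisinHodgeI2002, §11.3] -/
theorem hodgeAbelianDimGeEight_iff_hodgeAbelianVarieties :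
    HodgeAbelianDimGeEight ↔ ∀ A : AbelianVariety ℂ, HodgeConjectureFor A.dim A.X :=
  ⟨hodgeAbelianVarieties_of_hodgeAbelianDimGeEight, fun h A _ _ ↦ h A⟩

/-- **R1 alone proves the route's `Assembly`** (its conclusion, HC for abelian varieties of dimension `≤ 7`,
needs none of `CodimTwoFromLowerDim`, `CodimThreeWeilGeneration`, `WeilSixfolds`, `HodgeAbelianDimLeFive`).
[cite: VoisinHodgeI2002, §11.3] -/
theorem assembly_of_hodgeAbelianDimGeEight (h₈ : HodgeAbelianDimGeEight) : Assembly :=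
  fun _ _ _ _ A _ _ ↦ hodgeAbelianVarieties_of_hodgeAbelianDimGeEight h₈ A

/-- **The two declared residuals are jointly the summit**: `R1 → R2 → HodgeConjecture`, the attacked conjunct
absent (`R2` alone is already `↔ HodgeConjecture`, `abelianComplement_iff_hodgeConjecture`; the point here is
that `R1` swallows the conjunct). [cite: VoisinHodgeI2002, §11.3] -/
theorem hodgeConjecture_of_residuals (h₈ : HodgeAbelianDimGeEight) (h₉ : AbelianComplement) :
    _root_.HodgeConjecture := by
  intro n X hX
  by_cases hAb : ∃ A : AbelianVariety ℂ, A.dim = n ∧ A.X = X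
  · obtain ⟨A, rfl, rfl⟩ := hAb
    exact hodgeAbelianVarieties_of_hodgeAbelianDimGeEight h₈ A
  · exact h₉ hX fun A hA hAX ↦ hAb ⟨A, hA, hAX⟩

end Summit.HodgeConjecture.HodgeConjecture.Theorems.HodgeAbelianDimGeEight.Strength

end
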